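import Summits.CriticalPhenomena.SAWScalingLimit.Theorems.SAWDevelopingMapNoFoldBoundWalledClasses

/-!
# Winding classes at an interior vertex with a sealed neighbour (the double door trick)

Helper file for the crux `NoFoldBound` (stmt-CriticalPhenomena-8296) of the route
`SAWDevelopingMap` (sub-problem `SAWScalingLimit` of `CriticalPhenomena`), line `Ideator3Sketch`,
open stub `stub_slitCoherence` (interior vertices): the SEALED-PORT stratum.

Setting (Duminil-Copin–Smirnov 2012, §2): `Λ` a finite vertex set of the hexagonal lattice, a
source mid-edge `a`, an interior vertex `v ∈ Λ` off `a`, and a neighbour `w ∈ Λ` of `v` that is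
SEALED: every neighbour of `w` other than `v` lies outside `Λ` (so `w` hangs off `v`; any such
outside neighbour `x` gives a door `{w, x} ∈ ∂Ω` two steps from `v`).  A first arrival at `v`
through a port `p ≠ w` (a walk `a → {v, p}` avoiding `v`) cannot touch `w` (`sealed_notMem`),
hence extends by the two vertices `v, w` to a walk `a → {w, x}` to the door; by the rigidity of
windings between boundary mid-edges (`HexMidEdgeSAW.winding_eq_of_mem_boundary`) all these
double extensions have the same winding, whence `W(γ) + W(p → v → w) = W(γ') + W(p' → v → w)`
for first arrivals `γ, γ'` through ports `p, p' ≠ w` (`sealed_classes`): at such a vertex the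
first arrivals occupy only two (adjacent) winding classes.  Also: the sealed port itself
receives no first arrival unless the source sits at `w` (`mem_verts_of_sealed`), and if the
source sits at `w` the other two ports receive none (`mem_verts_of_sealed_source`) while the
first arrivals at the sealed port reduce to the one-step walk (`verts_eq_of_sealed_source`).

## Contents (namespace `Summit.CriticalPhenomena.SAWScalingLimit.Theorems.SAWDevelopingMapNoFoldBound`)
* `exists_stepExt` — extension of a first arrival by the vertex `v` to another mid-edge at `v`;
* `sealed_notMem`, `mem_verts_of_sealed`, `mem_verts_of_sealed_source`,
  `verts_eq_of_sealed_source` — the combinatorics of a sealed neighbour;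
* `exists_eq_target` — transport of a walk along `s(v, w) = s(w, v)`;
* **`sealed_classes`** / `helper_sealedClasses` — the two-class rigidity statement above.
-/

noncomputable section

open scoped BigOperators
open Literature.Probability.LatticeModels Literature.Probability.RandomPlanarGeometry.SAW

namespace Summit.CriticalPhenomena.SAWScalingLimit.Theorems.SAWDevelopingMapNoFoldBound

variable {Λ : Finset HexVertex} {a : Sym2 HexVertex} {v w p x : HexVertex}

/-! ### Extension by the vertex `v` -/

/-- **Step extension.** A first arrival `γ` at `v` through `p` (`v ∈ Λ`, `v ∉ a`, `v ∉ γ`)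
extends by the vertex `v` to a walk `γ.verts ++ [v]` from `a` to any other mid-edge `{v, w}` at
`v` (`w ∼ v`, `w ≠ p`; the new step `{p, v}` and the new half-edge `{v, w}` are unused because
`v ∉ γ`), with winding `W(γ) + W(mid{p,v} → c(v) → mid{v,w})`. [folklore] -/
theorem exists_stepExt (hv : v ∈ Λ) (hva : v ∉ a) (hvw : hexGraph.Adj v w)
    (hvp : hexGraph.Adj v p) (hpw : p ≠ w) (γ : HexMidEdgeSAW Λ a s(v, p))
    (hvγ : v ∉ γ.verts) :
    ∃ γ₁ : HexMidEdgeSAW Λ a s(v, w), γ₁.verts = γ.verts ++ [v] ∧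
      γ₁.winding = γ.winding + winding [hexMidpoint s(p, v), hexCenter v, hexMidpoint s(v, w)] := by
  have hne := arrival_verts_ne_nil hva γ
  have hlast := arrival_getLast?_eq hva γ hvγ
  obtain ⟨L₀, hL₀⟩ := List.getLast?_eq_some_iff.1 hlast
  refine ⟨⟨γ.verts ++ [v], ?_, ?_, ?_, ?_, ?_, ?_, fun _ => ?_, γ.fst_mem⟩, rfl, ?_⟩
  · -- the walk stays in the domain
    intro y hy
    rcases List.mem_append.1 hy with hy | hy
    · exact γ.subset y hy
    · rw [List.mem_singleton.1 hy]; exact hv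
  · -- self-avoiding
    exact List.nodup_append.2 ⟨γ.nodup, List.nodup_singleton v,
      fun y hy z hz hyz => hvγ (by rw [List.mem_singleton.1 hz] at hyz; exact hyz ▸ hy)⟩
  · -- consecutive vertices adjacent
    refine List.IsChain.append γ.isChain (List.isChain_singleton v) fun y hy z hz => ?_
    rw [Option.mem_def, hlast, Option.some.injEq] at hy
    rw [Option.mem_def, List.head?_cons, Option.some.injEq] at hz
    rw [← hy, ← hz]; exact hvp.symm
  · -- starts on `a`
    intro y hy
    rw [List.head?_append_of_ne_nil _ hne] at hy
    exact γ.head_mem y hy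
  · -- ends on `{v, w}`
    intro y hy
    rw [List.getLast?_concat, Option.some.injEq] at hy
    rw [← hy]; exact Sym2.mem_mk_left v w
  · -- nontrivial
    intro h; simp at h
  · -- no edge or half-edge is used twice
    rw [edges_concat hlast v, List.nodup_append]
    refine ⟨?_, List.nodup_singleton _, fun y hy z hz => ?_⟩
    · rw [Sym2.eq_swap (a := p) (b := v)]
      exact γ.edges_nodup hne
    · rw [List.mem_singleton] at hz
      subst hz
      rcases List.mem_cons.1 hy with rfl | hy
      · -- `a ≠ {v, w}` since `v ∉ a`
        intro h; exact hva (by rw [h]; exact Sym2.mem_mk_left v w)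
      rcases List.mem_append.1 hy with hy | hy
      · -- a step of `γ` does not contain `v ∉ γ`
        rintro rfl
        exact hvγ (forall_mem_of_mem_edges _ _ hy v (Sym2.mem_mk_left v w))
      · -- `{p, v} ≠ {v, w}` since `w ≠ p, v`
        rw [List.mem_singleton.1 hy]
        intro h
        have hw' : w ∈ s(p, v) := by rw [h]; exact Sym2.mem_mk_right v w
        rcases Sym2.mem_iff.1 hw' with h' | h'
        · exact hpw h'.symm
        · exact hvw.ne h'.symm
  · -- the winding
    refine winding_eq_of_verts_eq_concat γ _ hL₀ ?_
    change γ.verts ++ [v] = L₀ ++ [p, v]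
    rw [hL₀, List.append_assoc]
    rfl

/-! ### Combinatorics of a sealed neighbour -/

/-- A first arrival at `v` through a port `p ≠ w` does not visit the sealed neighbour `w` of `v`
(every neighbour of `w` other than `v` lies outside `Λ`): `w` is not its last vertex (`p ≠ w`),
and the successor of any earlier visit of `w` would be a neighbour of `w` inside `Λ` other than
`v`. [folklore] -/
theorem sealed_notMem (hva : v ∉ a) (hseal : ∀ y : HexVertex, hexGraph.Adj w y → y ≠ v → y ∉ Λ)
    (hpw : p ≠ w) (γ : HexMidEdgeSAW Λ a s(v, p)) (hvγ : v ∉ γ.verts) : w ∉ γ.verts := by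
  intro hw
  obtain ⟨L₁, L₂, hL⟩ := List.append_of_mem hw
  have hlast := arrival_getLast?_eq hva γ hvγ
  rcases L₂ with _ | ⟨q, L₂⟩
  · -- `w` would be the last vertex `p`
    rw [hL, List.getLast?_append, List.getLast?_singleton, Option.some_or,
      Option.some.injEq] at hlast
    exact hpw hlast.symm
  · -- the successor `q` of `w` is a neighbour of `w` in `Λ` other than `v`
    have hch := γ.isChain
    rw [hL] at hch
    have hwq : hexGraph.Adj w q := by
      have h2 := (List.isChain_append.1 hch).2.1
      exact (List.isChain_cons_cons.1 h2).1
    have hqΛ : q ∈ Λ := γ.subset q (by rw [hL]; simp)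
    have hqv : q ≠ v := fun h => hvγ (by rw [hL, ← h]; simp)
    exact hseal q hwq hqv hqΛ

/-- If the source is not at the sealed neighbour `w` (`w ∉ a`), the sealed port `{v, w}` receives
no first arrival: a walk `a → {v, w}` avoiding `v` ends at `w`, is not the one-vertex walk `[w]`
(its head lies on `a`), and the predecessor of `w` would be a neighbour of `w` inside `Λ` other
than `v`. [folklore] -/
theorem mem_verts_of_sealed (hva : v ∉ a) (hwa : w ∉ a)
    (hseal : ∀ y : HexVertex, hexGraph.Adj w y → y ≠ v → y ∉ Λ)
    (γ : HexMidEdgeSAW Λ a s(v, w)) : v ∈ γ.verts := by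
  by_contra hvγ
  have hne := arrival_verts_ne_nil hva γ
  have hlast := arrival_getLast?_eq hva γ hvγ
  obtain ⟨L₀, hL₀⟩ := List.getLast?_eq_some_iff.1 hlast
  rcases L₀.eq_nil_or_concat with h0 | ⟨L', r, h0⟩
  · -- `γ = [w]`: its head `w` lies on `a`
    rw [h0, List.nil_append] at hL₀
    exact hwa (γ.head_mem w (by rw [hL₀]; rfl))
  · -- the predecessor `r` of `w`
    rw [List.concat_eq_append] at h0
    rw [h0, List.append_assoc, List.singleton_append] at hL₀
    have hch := γ.isChain
    rw [hL₀] at hch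
    have hrw : hexGraph.Adj r w := by
      have h2 := (List.isChain_append.1 hch).2.1
      exact (List.isChain_cons_cons.1 h2).1
    have hrΛ : r ∈ Λ := γ.subset r (by rw [hL₀]; simp)
    have hrv : r ≠ v := fun h => hvγ (by rw [hL₀, ← h]; simp)
    exact hseal r hrw.symm hrv hrΛ

/-- If the source IS at the sealed neighbour `w` (`w ∈ a ∈ ∂Ω`), the two other ports receive no
first arrival: a walk from `a` starts at `w` (the vertex of `a` inside `Λ`), does not end there
(`p ≠ w`), and its second vertex would be a neighbour of `w` inside `Λ` other than `v`.
[folklore] -/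
theorem mem_verts_of_sealed_source (ha : a ∈ hexDomainBoundary Λ) (hw : w ∈ Λ) (hwa : w ∈ a)
    (hva : v ∉ a) (hseal : ∀ y : HexVertex, hexGraph.Adj w y → y ≠ v → y ∉ Λ) (hpw : p ≠ w)
    (γ : HexMidEdgeSAW Λ a s(v, p)) : v ∈ γ.verts := by
  by_contra hvγ
  have hne := arrival_verts_ne_nil hva γ
  have hlast := arrival_getLast?_eq hva γ hvγ
  obtain ⟨-, u', v', rfl, hv', hu'⟩ := ha
  have hwv' : w = v' := by
    rcases Sym2.mem_iff.1 hwa with h' | h'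
    · exact absurd (h' ▸ hw) hu'
    · exact h'
  subst hwv'
  obtain ⟨h, L, hL⟩ := List.exists_cons_of_ne_nil hne
  have hh : h = w := by
    have hha : h ∈ s(u', w) := γ.head_mem h (by rw [hL]; rfl)
    have hhΛ : h ∈ Λ := γ.subset h (by rw [hL]; simp)
    rcases Sym2.mem_iff.1 hha with h' | h'
    · exact absurd (h' ▸ hhΛ) hu'
    · exact h'
  subst hh
  rcases L with _ | ⟨q, L⟩
  · -- `γ = [w]` would end at `w ≠ p`
    rw [hL] at hlast
    simp only [List.getLast?_singleton, Option.some.injEq] at hlast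
    exact hpw hlast.symm
  · have hch := γ.isChain
    rw [hL] at hch
    have hwq : hexGraph.Adj h q := (List.isChain_cons_cons.1 hch).1
    have hqΛ : q ∈ Λ := γ.subset q (by rw [hL]; simp)
    have hqv : q ≠ v := fun h' => hvγ (by rw [hL, ← h']; simp)
    exact hseal q hwq hqv hqΛ

/-- If the source is at the sealed neighbour `w`, a first arrival at the sealed port `{v, w}` is
the one-vertex walk `[w]` (it starts and ends at `w` and is self-avoiding). [folklore] -/
theorem verts_eq_of_sealed_source (ha : a ∈ hexDomainBoundary Λ) (hw : w ∈ Λ) (hwa : w ∈ a)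
    (hva : v ∉ a) (γ : HexMidEdgeSAW Λ a s(v, w)) (hvγ : v ∉ γ.verts) : γ.verts = [w] := by
  have hne := arrival_verts_ne_nil hva γ
  have hlast := arrival_getLast?_eq hva γ hvγ
  obtain ⟨-, u', v', rfl, hv', hu'⟩ := ha
  have hwv' : w = v' := by
    rcases Sym2.mem_iff.1 hwa with h' | h'
    · exact absurd (h' ▸ hw) hu'
    · exact h'
  subst hwv'
  obtain ⟨h, L, hL⟩ := List.exists_cons_of_ne_nil hne
  have hh : h = w := by
    have hha : h ∈ s(u', w) := γ.head_mem h (by rw [hL]; rfl)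
    have hhΛ : h ∈ Λ := γ.subset h (by rw [hL]; simp)
    rcases Sym2.mem_iff.1 hha with h' | h'
    · exact absurd (h' ▸ hhΛ) hu'
    · exact h'
  subst hh
  rcases L.eq_nil_or_concat with h0 | ⟨L', r, h0⟩
  · rw [hL, h0]
  · exfalso
    rw [List.concat_eq_append] at h0
    rw [hL, h0, ← List.cons_append, List.getLast?_concat, Option.some.injEq] at hlast
    subst hlast
    have hnd := γ.nodup
    rw [hL, h0, List.nodup_cons] at hnd
    exact hnd.1 (by simp)

/-- Transport of a walk along an equality of target mid-edges (same vertices, same winding).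
[folklore] -/
theorem exists_eq_target {z z' : Sym2 HexVertex} (h : z = z') (γ : HexMidEdgeSAW Λ a z) :
    ∃ γ' : HexMidEdgeSAW Λ a z', γ'.verts = γ.verts ∧ γ'.winding = γ.winding := by
  subst h
  exact ⟨γ, rfl, rfl⟩

/-! ### The two-class rigidity -/

/-- **Winding classes at an interior vertex with a sealed neighbour (the double door trick).** Let
`Λ` be simply connected with source `a ∈ ∂Ω`, `v ∈ Λ` off `a`, `w ∈ Λ` a sealed neighbour of `v`
off `a` (every neighbour of `w` other than `v` lies outside `Λ`) and `x ∉ Λ` a neighbour of `w`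
other than `v`. Any two first arrivals `γ, γ'` at `v` through ports `p, p' ≠ w` (walks
`a → {v, p}`, `a → {v, p'}` avoiding `v`, possibly `p = p'`) satisfy
`W(γ) + W(p → v → w) = W(γ') + W(p' → v → w)`: adding `W(v → w → x)` to both sides gives the
windings of the double extensions `γ + v + w`, `γ' + v + w` from `a` to the BOUNDARY mid-edge
`{w, x}`, which agree by `HexMidEdgeSAW.winding_eq_of_mem_boundary`. [folklore] -/
theorem sealed_classes (hΛ : hexDomainSimplyConnected Λ) (ha : a ∈ hexDomainBoundary Λ)
    (hv : v ∈ Λ) (hva : v ∉ a) (hw : w ∈ Λ) (hwa : w ∉ a) (hvw : hexGraph.Adj v w)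
    (hseal : ∀ y : HexVertex, hexGraph.Adj w y → y ≠ v → y ∉ Λ)
    (hwx : hexGraph.Adj w x) (hxv : x ≠ v)
    {p p' : HexVertex} (hvp : hexGraph.Adj v p) (hvp' : hexGraph.Adj v p') (hpw : p ≠ w)
    (hp'w : p' ≠ w) (γ : HexMidEdgeSAW Λ a s(v, p)) (γ' : HexMidEdgeSAW Λ a s(v, p'))
    (hvγ : v ∉ γ.verts) (hvγ' : v ∉ γ'.verts) :
    γ.winding + winding [hexMidpoint s(p, v), hexCenter v, hexMidpoint s(v, w)] =
      γ'.winding + winding [hexMidpoint s(p', v), hexCenter v, hexMidpoint s(v, w)] := by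
  have hx : x ∉ Λ := hseal x hwx hxv
  -- first extensions, by `v`
  obtain ⟨γ₁, e₁, h₁⟩ := exists_stepExt hv hva hvw hvp hpw γ hvγ
  obtain ⟨γ₁', e₁', h₁'⟩ := exists_stepExt hv hva hvw hvp' hp'w γ' hvγ'
  -- `w` is not visited by the extensions
  have hw₁ : w ∉ γ₁.verts := by
    rw [e₁, List.mem_append, List.mem_singleton, not_or]
    exact ⟨sealed_notMem hva hseal hpw γ hvγ, hvw.ne.symm⟩
  have hw₁' : w ∉ γ₁'.verts := by
    rw [e₁', List.mem_append, List.mem_singleton, not_or]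
    exact ⟨sealed_notMem hva hseal hp'w γ' hvγ', hvw.ne.symm⟩
  -- retarget to `{w, v}` and extend by `w` to the door `{w, x}`
  obtain ⟨δ₁, f₁, g₁⟩ := exists_eq_target (Sym2.eq_swap (a := v) (b := w)) γ₁
  obtain ⟨δ₁', f₁', g₁'⟩ := exists_eq_target (Sym2.eq_swap (a := v) (b := w)) γ₁'
  obtain ⟨γ₂, -, h₂⟩ := exists_doorExt hx hw hwa hwx hvw.symm hxv.symm δ₁ (f₁ ▸ hw₁)
  obtain ⟨γ₂', -, h₂'⟩ := exists_doorExt hx hw hwa hwx hvw.symm hxv.symm δ₁' (f₁' ▸ hw₁')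
  have hrig := HexMidEdgeSAW.winding_eq_of_mem_boundary hΛ ha
    (door_mem_hexDomainBoundary hx hw hwx) γ₂ γ₂'
  rw [h₂, h₂', g₁, g₁', h₁, h₁'] at hrig
  linarith

/-- **Helper (registered form of `sealed_classes`).** In a simply connected `Λ` with source
`a ∈ ∂Ω`: for `v ∈ Λ` off `a`, a sealed neighbour `w ∈ Λ` of `v` off `a` (every neighbour of `w`
other than `v` outside `Λ`) and a neighbour `x ≠ v` of `w`, any two first arrivals at `v` through
ports `p, p' ≠ w` satisfy `W(γ) + W(p → v → w) = W(γ') + W(p' → v → w)`. [folklore] -/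
theorem helper_sealedClasses :
    ∀ (Λ : Finset HexVertex), hexDomainSimplyConnected Λ → ∀ a ∈ hexDomainBoundary Λ,
      ∀ (v w x : HexVertex), v ∈ Λ → v ∉ a → w ∈ Λ → w ∉ a → hexGraph.Adj v w →
      (∀ y : HexVertex, hexGraph.Adj w y → y ≠ v → y ∉ Λ) → hexGraph.Adj w x → x ≠ v →
      ∀ (p p' : HexVertex), hexGraph.Adj v p → hexGraph.Adj v p' → p ≠ w → p' ≠ w →
      ∀ (γ : HexMidEdgeSAW Λ a s(v, p)) (γ' : HexMidEdgeSAW Λ a s(v, p')),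
        v ∉ γ.verts → v ∉ γ'.verts →
        γ.winding + winding [hexMidpoint s(p, v), hexCenter v, hexMidpoint s(v, w)] =
          γ'.winding + winding [hexMidpoint s(p', v), hexCenter v, hexMidpoint s(v, w)] :=
  fun _ hΛ _ ha _ _ _ hv hva hw hwa hvw hseal hwx hxv _ _ hvp hvp' hpw hp'w γ γ' hvγ hvγ' =>
    sealed_classes hΛ ha hv hva hw hwa hvw hseal hwx hxv hvp hvp' hpw hp'w γ γ' hvγ hvγ'

end Summit.CriticalPhenomena.SAWScalingLimit.Theorems.SAWDevelopingMapNoFoldBound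

end
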